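import Mathlib
import Literature.Geometry.DiscreteGeometry.TwoShellPatterns

/-!
# Route `PhononSlackCertificates`, crux `NearFieldConvexity` (stmt-AtomisticToContinuum-13958),
line `Sketch`: stub `stub_chartCoverage` (S1, coverage)

For either two-shell pattern `P` (fcc or hcp: 12 points of norm `1`, 6 of norm `√2`), every point
`y` of the closed `2`-ball is within `141/100 - a/20` of `a • A v` for the centre `v = 0` or some
`v ∈ P` (`a ∈ [47/50, 1]`, `A` a linear isometry of `ℝ³`, hence onto: we may take `A = id`).
If `‖z‖ ≤ 141/100 - a/20` use the centre.  Otherwise `N = ‖z‖ ∈ (1.36, 2]`; sort the absolute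
coordinates, `p, q ≥ r`.  Either `3 (p + q)² ≥ 4 N²` and the first-shell point `(±e_p ± e_q)/√2`
(matching signs) is at squared distance `N² + a² - √2 a (p + q) ≤ N² + a² - (80/49) a N`, or one
coordinate dominates, `27 p² > 25 N²`, and the second-shell point `±√2 e_p` is at squared
distance `N² + 2a² - 2√2 a p`; both are `≤ (141/100 - a/20)²` (`coverage_key`; worst case the
tetrahedral-hole direction at `N = 2`).  For hcp (cuboctahedron coordinates, mirror plane
`x + y + z = 0`) these points are available in the closed upper half-space, and the lower one is
handled by the same computation in the reflected coordinates `z_m - (2/3)(z_0 + z_1 + z_2)`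
(lower triangle `(-1,-1,-4)/(3√2)`, lower second shell `(2,-4,-4)/(3√2)`).
-/

noncomputable section

open Literature.Geometry.DiscreteGeometry

namespace Summit.AtomisticToContinuum.Crystallization.Theorems.PhononSlackNearFieldConvexity

/-- Case (b) of the key inequality: sorted absolute coordinates `p ≥ q ≥ r ≥ 0` of a vector of
norm `N ∈ (141/100 - a/20, 2]` with `3 (p + q)² < 4 N²`: then `p` dominates (`q + r < p`) and the
second-shell point `√2 a e_p` is within `141/100 - a/20`. -/
private theorem coverage_key_b {a N p q r : ℝ} (ha : 47 / 50 ≤ a) (ha1 : a ≤ 1) (hr : 0 ≤ r)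
    (hrq : r ≤ q) (hqp : q ≤ p) (hN : N ≤ 2) (hS : p ^ 2 + q ^ 2 + r ^ 2 = N ^ 2)
    (hRN : 141 / 100 - a / 20 < N) (hA : 3 * (p + q) ^ 2 < 4 * N ^ 2) :
    q + r < p ∧ N ^ 2 + 2 * a ^ 2 - 2 * Real.sqrt 2 * a * p ≤ (141 / 100 - a / 20) ^ 2 := by
  have hq0 : 0 ≤ q := hr.trans hrq
  have hp0 : 0 ≤ p := hq0.trans hqp
  have hq2 : N ^ 2 - p ^ 2 ≤ 2 * q ^ 2 := by nlinarith
  have h1 : 2 * p * q < 5 * N ^ 2 / 6 - p ^ 2 / 2 := by nlinarith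
  have h2 : (2 * p * q) ^ 2 < (5 * N ^ 2 / 6 - p ^ 2 / 2) ^ 2 :=
    pow_lt_pow_left₀ h1 (by positivity) two_ne_zero
  have h3 : 2 * p ^ 2 * (N ^ 2 - p ^ 2) ≤ (2 * p * q) ^ 2 := by
    nlinarith [mul_le_mul_of_nonneg_left hq2 (sq_nonneg p)]
  have h4 : N ^ 2 ≤ 3 * p ^ 2 := by nlinarith
  have h5 : 25 * N ^ 2 < 27 * p ^ 2 := by
    by_contra hcon
    push Not at hcon
    nlinarith [mul_nonneg (sub_nonneg.2 hcon) (sub_nonneg.2 h4)]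
  constructor
  · have h6 : (q + r) ^ 2 < p ^ 2 := by nlinarith [sq_nonneg (q - r)]
    exact lt_of_pow_lt_pow_left₀ 2 hp0 h6
  · have ht : Real.sqrt 2 ^ 2 = 2 := Real.sq_sqrt (by norm_num)
    have hN0 : 0 ≤ N := by linarith
    have hD : N ^ 2 + 2 * a ^ 2 - (141 / 100 - a / 20) ^ 2 ≤ 2558 / 1000 * N := by
      nlinarith [mul_nonneg (sub_nonneg.2 hRN.le) (sub_nonneg.2 hN)]
    have ha2 : 8836 / 10000 ≤ a ^ 2 := by nlinarith
    have h8 : (2 * Real.sqrt 2 * a * p) ^ 2 = 8 * a ^ 2 * p ^ 2 := by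
      rw [show (2 * Real.sqrt 2 * a * p) ^ 2 = 4 * Real.sqrt 2 ^ 2 * a ^ 2 * p ^ 2 by ring, ht]
      ring
    have hE : (2558 / 1000 * N) ^ 2 ≤ (2 * Real.sqrt 2 * a * p) ^ 2 := by
      rw [h8]
      nlinarith [mul_le_mul_of_nonneg_right ha2 (sq_nonneg p)]
    have hF : 2558 / 1000 * N ≤ 2 * Real.sqrt 2 * a * p :=
      le_of_pow_le_pow_left₀ two_ne_zero (by positivity) hE
    linarith

/-- **The key real inequality** (`a ∈ [47/50, 1]`, norm `N ∈ (141/100 - a/20, 2]`, absolute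
coordinates `p, q ≥ r ≥ 0`): the first-shell point `(±e_p ± e_q)/√2` or a second-shell point
`±√2 e_p` / `±√2 e_q` (whose coordinate then dominates the others) is within `141/100 - a/20`. -/
private theorem coverage_key {a N p q r : ℝ} (ha : 47 / 50 ≤ a) (ha1 : a ≤ 1) (hr : 0 ≤ r)
    (hrp : r ≤ p) (hrq : r ≤ q) (hN : N ≤ 2) (hS : p ^ 2 + q ^ 2 + r ^ 2 = N ^ 2)
    (hRN : 141 / 100 - a / 20 < N) :
    N ^ 2 + a ^ 2 - Real.sqrt 2 * a * (p + q) ≤ (141 / 100 - a / 20) ^ 2 ∨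
    (q + r < p ∧ N ^ 2 + 2 * a ^ 2 - 2 * Real.sqrt 2 * a * p ≤ (141 / 100 - a / 20) ^ 2) ∨
    (p + r < q ∧ N ^ 2 + 2 * a ^ 2 - 2 * Real.sqrt 2 * a * q ≤ (141 / 100 - a / 20) ^ 2) := by
  by_cases hA : 4 * N ^ 2 ≤ 3 * (p + q) ^ 2
  · left
    have ht : Real.sqrt 2 ^ 2 = 2 := Real.sq_sqrt (by norm_num)
    have hN0 : 0 ≤ N := by linarith
    have hu : 0 ≤ p + q := by linarith
    have h1 : (80 / 49 * N) ^ 2 ≤ (Real.sqrt 2 * (p + q)) ^ 2 := by nlinarith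
    have h2 : 80 / 49 * N ≤ Real.sqrt 2 * (p + q) :=
      le_of_pow_le_pow_left₀ two_ne_zero (by positivity) h1
    have h3 : 80 / 49 * a * N ≤ Real.sqrt 2 * a * (p + q) := by nlinarith
    nlinarith [mul_nonneg (sub_nonneg.2 hN) (by linarith : (0:ℝ) ≤ N + 2 - 80 / 49 * a),
      mul_nonneg (sub_nonneg.2 ha) (sub_nonneg.2 ha1)]
  · right
    push Not at hA
    rcases le_total q p with hqp | hpq
    · exact Or.inl (coverage_key_b ha ha1 hr hrq hqp hN hS hRN hA)
    · exact Or.inr (coverage_key_b ha ha1 hr hrp hpq hN (by linarith) hRN (by linarith))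

/-- `‖z‖² = z₀² + z₁² + z₂²`. -/
private theorem norm_sq_three (z : EuclideanSpace ℝ (Fin 3)) :
    ‖z‖ ^ 2 = z 0 ^ 2 + z 1 ^ 2 + z 2 ^ 2 := by
  rw [EuclideanSpace.real_norm_sq_eq, Fin.sum_univ_three]

/-- Squared distance from `z` to a multiple of an integer vector, in coordinates. -/
private theorem norm_sub_smul_intVec_sq (z : EuclideanSpace ℝ (Fin 3)) (c : ℝ) (f : Fin 3 → ℤ) :
    ‖z - c • intVec f‖ ^ 2 =
      ‖z‖ ^ 2 - 2 * c * (z 0 * f 0 + z 1 * f 1 + z 2 * f 2) +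
        c ^ 2 * ((f 0 : ℝ) ^ 2 + (f 1 : ℝ) ^ 2 + (f 2 : ℝ) ^ 2) := by
  rw [EuclideanSpace.real_norm_sq_eq, EuclideanSpace.real_norm_sq_eq, Fin.sum_univ_three,
    Fin.sum_univ_three]
  simp only [PiLp.sub_apply, PiLp.smul_apply, smul_eq_mul, intVec_apply]
  ring

/-- Squared distance to `c • (sᵢ eᵢ + sⱼ eⱼ)`. -/
private theorem norm_sub_pair_sq (z : EuclideanSpace ℝ (Fin 3)) (c : ℝ) {i j : Fin 3}
    (hij : i ≠ j) (si sj : ℤ) :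
    ‖z - c • intVec (Pi.single i si + Pi.single j sj)‖ ^ 2 =
      ‖z‖ ^ 2 - 2 * c * (si * z i + sj * z j) + c ^ 2 * ((si : ℝ) ^ 2 + (sj : ℝ) ^ 2) := by
  rw [norm_sub_smul_intVec_sq]
  congr 1
  · congr 2
    fin_cases i <;> fin_cases j <;> simp at hij ⊢ <;> ring
  · congr 1
    fin_cases i <;> fin_cases j <;> simp at hij ⊢ <;> ring

/-- Squared distance to `c • t eᵢ`. -/
private theorem norm_sub_single_sq (z : EuclideanSpace ℝ (Fin 3)) (c : ℝ) (i : Fin 3) (t : ℤ) :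
    ‖z - c • intVec (Pi.single i t)‖ ^ 2 = ‖z‖ ^ 2 - 2 * c * (t * z i) + c ^ 2 * (t : ℝ) ^ 2 := by
  rw [norm_sub_smul_intVec_sq]
  congr 1
  · congr 2
    fin_cases i <;> simp <;> ring
  · congr 1
    fin_cases i <;> simp

/-- Squared distance to `c • ((-1, -1, -1) - 3 e_k)` (a lower-triangle direction of hcp). -/
private theorem norm_sub_lowerTri_sq (z : EuclideanSpace ℝ (Fin 3)) (c : ℝ) (k : Fin 3) :
    ‖z - c • intVec (fun m => if m = k then (-4 : ℤ) else -1)‖ ^ 2 =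
      ‖z‖ ^ 2 + 2 * c * (z 0 + z 1 + z 2 + 3 * z k) + c ^ 2 * 18 := by
  rw [norm_sub_smul_intVec_sq]
  fin_cases k <;> simp <;> ring

/-- Squared distance to `c • (6 eᵢ - (4, 4, 4))` (a lower second-shell direction of hcp). -/
private theorem norm_sub_lowerSnd_sq (z : EuclideanSpace ℝ (Fin 3)) (c : ℝ) (i : Fin 3) :
    ‖z - c • intVec (fun m => if m = i then (2 : ℤ) else -4)‖ ^ 2 =
      ‖z‖ ^ 2 - 2 * c * (6 * z i - 4 * (z 0 + z 1 + z 2)) + c ^ 2 * 36 := by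
  rw [norm_sub_smul_intVec_sq]
  fin_cases i <;> simp <;> ring

/-- Sorting the absolute values of three reals: an index `k` of a smallest one, the two other
indices, and the two symmetric functions of the entries used below. -/
private theorem sorted_abs (f : Fin 3 → ℝ) :
    ∃ i j k : Fin 3, i ≠ j ∧ i ≠ k ∧ j ≠ k ∧ |f k| ≤ |f i| ∧ |f k| ≤ |f j| ∧
      |f i| ^ 2 + |f j| ^ 2 + |f k| ^ 2 = f 0 ^ 2 + f 1 ^ 2 + f 2 ^ 2 ∧
      f i + f j + f k = f 0 + f 1 + f 2 := by
  obtain ⟨k, hk⟩ := Finite.exists_min fun m => |f m|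
  simp only [sq_abs]
  fin_cases k
  · exact ⟨1, 2, 0, by decide, by decide, by decide, hk 1, hk 2, by ring, by ring⟩
  · exact ⟨0, 2, 1, by decide, by decide, by decide, hk 0, hk 2, by ring, by ring⟩
  · exact ⟨0, 1, 2, by decide, by decide, by decide, hk 0, hk 1, by ring, by ring⟩

/-- In the closed upper half-space, two coordinates dominating the third are not both negative. -/
private theorem nonneg_or_nonneg {f : Fin 3 → ℝ} {i j k : Fin 3} (hs : 0 ≤ f i + f j + f k)
    (hki : |f k| ≤ |f i|) : 0 ≤ f i ∨ 0 ≤ f j := by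
  by_contra hneg
  push Not at hneg
  linarith [abs_of_neg hneg.1, abs_of_neg hneg.2, le_abs_self (f k)]

/-- In the closed upper half-space, a coordinate dominating the two others is non-negative. -/
private theorem nonneg_of_dominant {f : Fin 3 → ℝ} {i j k : Fin 3} (hs : 0 ≤ f i + f j + f k)
    (h : |f j| + |f k| < |f i|) : 0 ≤ f i := by
  by_contra hneg
  linarith [abs_of_neg (not_le.1 hneg), le_abs_self (f j), le_abs_self (f k)]

/-- A sign `s = ±1` (so `s² = 1`) with `s x = |x|`, equal to `1` when `x ≥ 0`. -/
private theorem exists_sign (x : ℝ) : ∃ s : ℤ, s ∈ ({1, -1} : Finset ℤ) ∧ (s : ℝ) ^ 2 = 1 ∧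
    (s : ℝ) * x = |x| ∧ (0 ≤ x → s = 1) := by
  by_cases h : 0 ≤ x
  · exact ⟨1, by simp, by simp, by rw [abs_of_nonneg h]; simp, fun _ => rfl⟩
  · exact ⟨-1, by simp, by simp, by rw [abs_of_neg (not_le.1 h)]; simp, fun h' => absurd h' h⟩

/-- The twelve first-shell fcc vectors `sᵢ eᵢ + sⱼ eⱼ`. -/
private theorem pair_mem_fccInt :
    ∀ i j : Fin 3, i ≠ j → ∀ si ∈ ({1, -1} : Finset ℤ), ∀ sj ∈ ({1, -1} : Finset ℤ),
      Pi.single i si + Pi.single j sj ∈ fccInt ∪ fccSecondShellInt := by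
  decide

/-- The six second-shell fcc vectors `2 sᵢ eᵢ`. -/
private theorem single_mem_fccInt :
    ∀ i : Fin 3, ∀ si ∈ ({1, -1} : Finset ℤ),
      Pi.single i (2 * si) ∈ fccInt ∪ fccSecondShellInt := by
  decide

/-- The hexagon and the upper triangle of hcp: `3 sᵢ eᵢ + 3 sⱼ eⱼ`, not both signs negative. -/
private theorem pair_mem_hcpInt :
    ∀ i j : Fin 3, i ≠ j → ∀ si ∈ ({1, -1} : Finset ℤ), ∀ sj ∈ ({1, -1} : Finset ℤ),
      (si = 1 ∨ sj = 1) →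
        Pi.single i (3 * si) + Pi.single j (3 * sj) ∈ hcpInt ∪ hcpSecondShellInt := by
  decide

/-- The upper second shell of hcp: `6 eᵢ`. -/
private theorem single_mem_hcpInt : ∀ i : Fin 3, Pi.single i 6 ∈ hcpInt ∪ hcpSecondShellInt := by
  decide

/-- The lower triangle of hcp: `(-1, -1, -1) - 3 e_k`. -/
private theorem lowerTri_mem_hcpInt :
    ∀ k : Fin 3, (fun m => if m = k then (-4 : ℤ) else -1) ∈ hcpInt ∪ hcpSecondShellInt := by
  decide

/-- The lower second shell of hcp: `6 eᵢ - (4, 4, 4)`. -/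
private theorem lowerSnd_mem_hcpInt :
    ∀ i : Fin 3, (fun m => if m = i then (2 : ℤ) else -4) ∈ hcpInt ∪ hcpSecondShellInt := by
  decide

/-- Scaled integer vectors of `fccInt ∪ fccSecondShellInt` are points of the fcc pattern
(`(√2)⁻¹ = √2/2`). -/
private theorem mem_fcc_of {w : Fin 3 → ℤ} (hw : w ∈ fccInt ∪ fccSecondShellInt) :
    (Real.sqrt 2 / 2) • intVec w ∈ fccTwoShellPattern := by
  rw [Real.sqrt_div_self]
  refine Finset.mem_image.2 ⟨w, hw, ?_⟩
  norm_num

/-- Scaled integer vectors of `hcpInt ∪ hcpSecondShellInt` are points of the hcp pattern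
(`(√18)⁻¹ = √2/6`). -/
private theorem mem_hcp_of {w : Fin 3 → ℤ} (hw : w ∈ hcpInt ∪ hcpSecondShellInt) :
    (Real.sqrt 2 / 6) • intVec w ∈ hcpTwoShellPattern := by
  have h18 : (Real.sqrt 18)⁻¹ = Real.sqrt 2 / 6 := by
    rw [show (18 : ℝ) = 3 ^ 2 * 2 by norm_num, Real.sqrt_mul (by norm_num) 2,
      Real.sqrt_sq (by norm_num), mul_inv, ← Real.sqrt_div_self]
    ring
  rw [← h18]
  refine Finset.mem_image.2 ⟨w, hw, ?_⟩
  norm_num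

/-- fcc, first shell: the point `(sᵢ eᵢ + sⱼ eⱼ)/√2` with the signs of `zᵢ, zⱼ`. -/
private theorem fcc_pair (z : EuclideanSpace ℝ (Fin 3)) (a : ℝ) {i j : Fin 3} (hij : i ≠ j) :
    ∃ v ∈ fccTwoShellPattern,
      ‖z - a • v‖ ^ 2 = ‖z‖ ^ 2 + a ^ 2 - Real.sqrt 2 * a * (|z i| + |z j|) := by
  obtain ⟨si, hsi, hsi2, hsiz, -⟩ := exists_sign (z i)
  obtain ⟨sj, hsj, hsj2, hsjz, -⟩ := exists_sign (z j)
  refine ⟨_, mem_fcc_of (pair_mem_fccInt i j hij si hsi sj hsj), ?_⟩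
  have ht : Real.sqrt 2 ^ 2 = 2 := Real.sq_sqrt (by norm_num)
  rw [smul_smul, norm_sub_pair_sq z _ hij, hsiz, hsjz, hsi2, hsj2]
  linear_combination (a ^ 2 / 2) * ht

/-- fcc, second shell: the point `√2 sᵢ eᵢ` with the sign of `zᵢ`. -/
private theorem fcc_single (z : EuclideanSpace ℝ (Fin 3)) (a : ℝ) (i : Fin 3) :
    ∃ v ∈ fccTwoShellPattern,
      ‖z - a • v‖ ^ 2 = ‖z‖ ^ 2 + 2 * a ^ 2 - 2 * Real.sqrt 2 * a * |z i| := by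
  obtain ⟨si, hsi, hs2, hsiz, -⟩ := exists_sign (z i)
  refine ⟨_, mem_fcc_of (single_mem_fccInt i si hsi), ?_⟩
  have ht : Real.sqrt 2 ^ 2 = 2 := Real.sq_sqrt (by norm_num)
  rw [smul_smul, norm_sub_single_sq z _ i]
  push_cast
  rw [← hsiz]
  linear_combination (a ^ 2 * (si : ℝ) ^ 2) * ht + (2 * a ^ 2) * hs2

/-- hcp, hexagon or upper triangle: the point `(sᵢ eᵢ + sⱼ eⱼ)/√2` with the signs of `zᵢ, zⱼ`,
available when these are not both negative. -/
private theorem hcp_pair_upper (z : EuclideanSpace ℝ (Fin 3)) (a : ℝ) {i j : Fin 3} (hij : i ≠ j)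
    (hpos : 0 ≤ z i ∨ 0 ≤ z j) :
    ∃ v ∈ hcpTwoShellPattern,
      ‖z - a • v‖ ^ 2 = ‖z‖ ^ 2 + a ^ 2 - Real.sqrt 2 * a * (|z i| + |z j|) := by
  obtain ⟨si, hsi, hs2, hsiz, hsi1⟩ := exists_sign (z i)
  obtain ⟨sj, hsj, hs2', hsjz, hsj1⟩ := exists_sign (z j)
  refine ⟨_, mem_hcp_of (pair_mem_hcpInt i j hij si hsi sj hsj (hpos.imp hsi1 hsj1)), ?_⟩
  have ht : Real.sqrt 2 ^ 2 = 2 := Real.sq_sqrt (by norm_num)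
  rw [smul_smul, norm_sub_pair_sq z _ hij]
  push_cast
  rw [← hsiz, ← hsjz]
  linear_combination (a ^ 2 / 4 * ((si : ℝ) ^ 2 + (sj : ℝ) ^ 2)) * ht +
    (a ^ 2 / 2) * hs2 + (a ^ 2 / 2) * hs2'

/-- hcp, upper second shell: the point `√2 eᵢ`, for `zᵢ ≥ 0`. -/
private theorem hcp_single_upper (z : EuclideanSpace ℝ (Fin 3)) (a : ℝ) (i : Fin 3)
    (hpos : 0 ≤ z i) :
    ∃ v ∈ hcpTwoShellPattern,
      ‖z - a • v‖ ^ 2 = ‖z‖ ^ 2 + 2 * a ^ 2 - 2 * Real.sqrt 2 * a * |z i| := by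
  refine ⟨_, mem_hcp_of (single_mem_hcpInt i), ?_⟩
  have ht : Real.sqrt 2 ^ 2 = 2 := Real.sq_sqrt (by norm_num)
  rw [smul_smul, norm_sub_single_sq z _ i, abs_of_nonneg hpos]
  push_cast
  linear_combination (a ^ 2) * ht

/-- hcp, hexagon or lower triangle, in the reflected coordinates
`w_m = z_m - (2/3)(z_0 + z_1 + z_2)` with `wᵢ, wⱼ` not both negative: the hexagon point
`(sᵢ eᵢ + sⱼ eⱼ)/√2` for mixed signs, the lower-triangle point `((-1,-1,-1) - 3e_k)/(3√2)` for
`wᵢ, wⱼ ≥ 0`, at squared distance `‖z‖² + a² - √2 a (|wᵢ| + |wⱼ|)`. -/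
private theorem hcp_pair_lower (z : EuclideanSpace ℝ (Fin 3)) (a : ℝ) {w : Fin 3 → ℝ}
    (hw : ∀ m, w m = z m - 2 * (z 0 + z 1 + z 2) / 3) {i j k : Fin 3} (hij : i ≠ j)
    (hsum : z i + z j + z k = z 0 + z 1 + z 2) (hpos : 0 ≤ w i ∨ 0 ≤ w j) :
    ∃ v ∈ hcpTwoShellPattern,
      ‖z - a • v‖ ^ 2 = ‖z‖ ^ 2 + a ^ 2 - Real.sqrt 2 * a * (|w i| + |w j|) := by
  have ht : Real.sqrt 2 ^ 2 = 2 := Real.sq_sqrt (by norm_num)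
  by_cases hi : 0 ≤ w i
  · by_cases hj : 0 ≤ w j
    · -- the lower-triangle point below `e_k`
      refine ⟨_, mem_hcp_of (lowerTri_mem_hcpInt k), ?_⟩
      rw [smul_smul, norm_sub_lowerTri_sq z _ k, abs_of_nonneg hi, abs_of_nonneg hj, hw i, hw j]
      linear_combination (a ^ 2 / 2) * ht + (Real.sqrt 2 * a) * hsum
    · -- the hexagon point `(eᵢ - eⱼ)/√2`
      refine ⟨_, mem_hcp_of (pair_mem_hcpInt i j hij 1 (by simp) (-1) (by simp) (Or.inl rfl)), ?_⟩
      rw [smul_smul, norm_sub_pair_sq z _ hij, abs_of_nonneg hi, abs_of_neg (not_le.1 hj), hw i,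
        hw j]
      push_cast
      linear_combination (a ^ 2 / 2) * ht
  · -- the hexagon point `(eⱼ - eᵢ)/√2`
    have hj : 0 ≤ w j := hpos.resolve_left hi
    refine ⟨_, mem_hcp_of (pair_mem_hcpInt i j hij (-1) (by simp) 1 (by simp) (Or.inr rfl)), ?_⟩
    rw [smul_smul, norm_sub_pair_sq z _ hij, abs_of_neg (not_le.1 hi), abs_of_nonneg hj, hw i,
      hw j]
    push_cast
    linear_combination (a ^ 2 / 2) * ht

/-- hcp, lower second shell, in the reflected coordinates: for `wᵢ ≥ 0` the point
`(6eᵢ - (4,4,4))/(3√2)` is at squared distance `‖z‖² + 2a² - 2√2 a wᵢ`. -/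
private theorem hcp_single_lower (z : EuclideanSpace ℝ (Fin 3)) (a : ℝ) {w : Fin 3 → ℝ}
    (hw : ∀ m, w m = z m - 2 * (z 0 + z 1 + z 2) / 3) (i : Fin 3) (hpos : 0 ≤ w i) :
    ∃ v ∈ hcpTwoShellPattern,
      ‖z - a • v‖ ^ 2 = ‖z‖ ^ 2 + 2 * a ^ 2 - 2 * Real.sqrt 2 * a * |w i| := by
  have ht : Real.sqrt 2 ^ 2 = 2 := Real.sq_sqrt (by norm_num)
  refine ⟨_, mem_hcp_of (lowerSnd_mem_hcpInt i), ?_⟩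
  rw [smul_smul, norm_sub_lowerSnd_sq z _ i, abs_of_nonneg hpos, hw i]
  linear_combination (a ^ 2) * ht

/-- Coverage by the fcc pattern, for `‖z‖ ∈ (141/100 - a/20, 2]`. -/
private theorem cover_fcc {a : ℝ} (ha : 47 / 50 ≤ a) (ha1 : a ≤ 1) (z : EuclideanSpace ℝ (Fin 3))
    (hz : ‖z‖ ≤ 2) (hbig : 141 / 100 - a / 20 < ‖z‖) :
    ∃ v ∈ fccTwoShellPattern, ‖z - a • v‖ ^ 2 ≤ (141 / 100 - a / 20) ^ 2 := by
  obtain ⟨i, j, k, hij, -, -, hki, hkj, hS, -⟩ := sorted_abs (WithLp.ofLp z)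
  rw [← norm_sq_three] at hS
  rcases coverage_key ha ha1 (abs_nonneg _) hki hkj hz hS hbig with h | ⟨-, h⟩ | ⟨-, h⟩
  · obtain ⟨v, hv, hv2⟩ := fcc_pair z a hij
    exact ⟨v, hv, by rw [hv2]; exact h⟩
  · obtain ⟨v, hv, hv2⟩ := fcc_single z a i
    exact ⟨v, hv, by rw [hv2]; exact h⟩
  · obtain ⟨v, hv, hv2⟩ := fcc_single z a j
    exact ⟨v, hv, by rw [hv2]; exact h⟩

/-- Coverage by the hcp pattern, for `‖z‖ ∈ (141/100 - a/20, 2]`: the fcc choices in the closed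
upper half-space `z_0 + z_1 + z_2 ≥ 0`, their mirror images in the lower one. -/
private theorem cover_hcp {a : ℝ} (ha : 47 / 50 ≤ a) (ha1 : a ≤ 1) (z : EuclideanSpace ℝ (Fin 3))
    (hz : ‖z‖ ≤ 2) (hbig : 141 / 100 - a / 20 < ‖z‖) :
    ∃ v ∈ hcpTwoShellPattern, ‖z - a • v‖ ^ 2 ≤ (141 / 100 - a / 20) ^ 2 := by
  rcases le_total 0 (z 0 + z 1 + z 2) with hs | hs
  · -- upper half-space
    obtain ⟨i, j, k, hij, -, -, hki, hkj, hS, hsum⟩ := sorted_abs (WithLp.ofLp z)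
    rw [← norm_sq_three] at hS
    rw [← hsum] at hs
    rcases coverage_key ha ha1 (abs_nonneg _) hki hkj hz hS hbig with h | ⟨hqr, h⟩ | ⟨hpr, h⟩
    · obtain ⟨v, hv, hv2⟩ := hcp_pair_upper z a hij (nonneg_or_nonneg hs hki)
      exact ⟨v, hv, by rw [hv2]; exact h⟩
    · obtain ⟨v, hv, hv2⟩ := hcp_single_upper z a i (nonneg_of_dominant hs hqr)
      exact ⟨v, hv, by rw [hv2]; exact h⟩
    · obtain ⟨v, hv, hv2⟩ := hcp_single_upper z a j (nonneg_of_dominant (by linarith) hpr)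
      exact ⟨v, hv, by rw [hv2]; exact h⟩
  · -- lower half-space: the same in the reflected coordinates `w`
    obtain ⟨w, hw⟩ : ∃ w : Fin 3 → ℝ, ∀ m, w m = z m - 2 * (z 0 + z 1 + z 2) / 3 :=
      ⟨_, fun _ => rfl⟩
    obtain ⟨i, j, k, hij, -, -, hki, hkj, hS, hsum⟩ := sorted_abs w
    have hzsum : z i + z j + z k = z 0 + z 1 + z 2 := by
      rw [hw i, hw j, hw k, hw 0, hw 1, hw 2] at hsum
      linarith
    have hs' : 0 ≤ w i + w j + w k := by
      rw [hw i, hw j, hw k]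
      linarith
    replace hS : |w i| ^ 2 + |w j| ^ 2 + |w k| ^ 2 = ‖z‖ ^ 2 := by
      rw [hS, norm_sq_three, hw 0, hw 1, hw 2]
      ring
    rcases coverage_key ha ha1 (abs_nonneg _) hki hkj hz hS hbig with h | ⟨hqr, h⟩ | ⟨hpr, h⟩
    · obtain ⟨v, hv, hv2⟩ := hcp_pair_lower z a hw hij hzsum (nonneg_or_nonneg hs' hki)
      exact ⟨v, hv, by rw [hv2]; exact h⟩
    · obtain ⟨v, hv, hv2⟩ := hcp_single_lower z a hw i (nonneg_of_dominant hs' hqr)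
      exact ⟨v, hv, by rw [hv2]; exact h⟩
    · obtain ⟨v, hv, hv2⟩ := hcp_single_lower z a hw j (nonneg_of_dominant (by linarith) hpr)
      exact ⟨v, hv, by rw [hv2]; exact h⟩

/-- **Stub S1 (coverage).**  For either two-shell pattern `P`, every point `y` of the closed
`2`-ball is within `141/100 − a/20` of `a • A v` for some `v ∈ {0} ∪ P` (`a ∈ [47/50, 1]`, `A` a
linear isometry of `ℝ³`).  Worst case: the tetrahedral-hole direction at `‖y‖ = 2`. -/
theorem stub_chartCoverage :
    ∀ P : Finset (EuclideanSpace ℝ (Fin 3)), (P = fccTwoShellPattern ∨ P = hcpTwoShellPattern) →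
      ∀ (A : EuclideanSpace ℝ (Fin 3) →ₗᵢ[ℝ] EuclideanSpace ℝ (Fin 3)) (a : ℝ),
        47 / 50 ≤ a → a ≤ 1 → ∀ y : EuclideanSpace ℝ (Fin 3), ‖y‖ ≤ 2 →
          ∃ v ∈ insert (0 : EuclideanSpace ℝ (Fin 3)) P, ‖y - a • A v‖ ≤ 141 / 100 - a / 20 := by
  intro P hP A a ha ha1 y hy
  -- `A` is onto (equal finite dimensions): write `y = A z`, so `‖y - a • A v‖ = ‖z - a • v‖`
  obtain ⟨z, rfl⟩ : ∃ z, A z = y := (A.toLinearIsometryEquiv rfl).surjective y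
  have key : ∀ v, ‖A z - a • A v‖ = ‖z - a • v‖ := fun v => by
    rw [← A.norm_map (z - a • v), map_sub, map_smul]
  rw [A.norm_map] at hy
  simp only [key]
  by_cases hsmall : ‖z‖ ≤ 141 / 100 - a / 20
  · exact ⟨0, Finset.mem_insert_self _ _, by simpa using hsmall⟩
  have hbig : 141 / 100 - a / 20 < ‖z‖ := not_le.1 hsmall
  obtain ⟨v, hv, h⟩ : ∃ v ∈ P, ‖z - a • v‖ ^ 2 ≤ (141 / 100 - a / 20) ^ 2 := by
    rcases hP with rfl | rfl
    · exact cover_fcc ha ha1 z hy hbig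
    · exact cover_hcp ha ha1 z hy hbig
  exact ⟨v, Finset.mem_insert_of_mem hv, le_of_pow_le_pow_left₀ two_ne_zero (by linarith) h⟩

end Summit.AtomisticToContinuum.Crystallization.Theorems.PhononSlackNearFieldConvexity
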